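import Summits.BirchSwinnertonDyer.Rank1Residual.GaloisImage.MordellWeilIndexCertificates
import Summits.BirchSwinnertonDyer.Rank1Residual.Additive.X4RankZeroVisibleLowerBound
import HarnessLib

/-!
# X4 ∧ `r = 0`: `BSD(E,3)` from a VISIBLE element of `Ш(E)[3]` by the COUNT road with the
# partner's rank input `hrank : 2 ≤ rank E′(ℚ)` REPLACED by the KERNEL index certificate
# `9 ≤ [E′(ℚ) : 3E′(ℚ)]` (team n1011, row T-DIV3L, FILE D8 "T-IDX3" — the `…_of_indexChecks` twins
# of n1011-p03's `X4RankZero.bsdp_*_of_congr_of_rank_two*`; names notice 2026-08-21T23:58Z)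

HONEST FRAMING (cell `b2b-bsdres`, run/shared/lean/b2b/bsd-rank1-residual/, verbatim in every
file): the goal of the cell is to DELETE the COMBINATION-SHAPED residual classes of the
Birch–Swinnerton-Dyer formula for ALL analytic-rank `≤ 1` elliptic curves over `ℚ` — "full BSD
formula for every rank `≤ 1` curve in class `C`" assembled STRICTLY from published theorems — so
that the rank-`≤ 1` remainder becomes exactly the CONSTRUCTION-SHAPED classes, which are TYPED
(missing-input `Prop`s), NOT attempted. This is not "finishing BSD". Team n1011 (N10/N11): research
route on the CONSTRUCTION-SHAPED class X4; END theorems only (no definition, no named fact, no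
`sorry`); CONDITIONAL on exactly the named inputs displayed as hypotheses, as n1011-p03's ENDs;
nothing is booked; no mark / label / count moved; X4 stays CONSTRUCTION-SHAPED.

## What

n1011-p03's two T-VIS3 ENDs (p304185; and n1011-p18's prime-list adapters / row shapes over them)
take the partner's Mordell–Weil rank as the displayed EVIDENCE binder `hrank : 2 ≤ W′.mordellWeilRank`
(Cremona) and feed it ONLY into the count `3 · [E(ℚ):3E(ℚ)] · ∏ #E′(ℚ_v)[3] < [E′(ℚ):3E′(ℚ)]`
(tree `WeierstrassCurve.exists_sha_ne_zero_of_congr`). FILE D7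
`DivisionDecider.nine_le_index_range_zsmul_three_of_checks[_inst]` certifies `9 ≤ [E′(ℚ):3E′(ℚ)]`
in the kernel from two rational points `P₁, P₂ ∈ E′(ℚ)`, the chord points `P₁ ± P₂` (two
`decide`-able identities) and four `threeNonDivCheckAt` certificates. The twins below make that
swap — binder lists VERBATIM p304185's except `hrank` ↦ the certificate binders; `S`, `hS`, `hloc`
unchanged (so n1011-p18's `(T)` prime-list pattern applies unchanged on top). These ENDs close
nothing beyond their displayed binders (`hr`, `hX`, `hsurj`, Manin / `hj`, `hq`/`hv`, `θ`/`hθ`,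
`hloc`); census (EVIDENCE, `HOME/b2b-bsdres-n1011-p17/gen9/census/idx3_certs.json`): all 15 254
rank-`≥ 2` partners of r1's `route1/g29_cvis_pairs.tsv` carry the four NO-primes (`ℓ ≤ 101`,
`k ≤ 4`).

References: [CremonaMazur2000] §3; [AgasheStein2002] Thm. 3.1; [Kato2004Asterisque] Thm. 14.5 (3);
[Delbourgo1998] Prop. 4; [SilvermanAEC2009] X.4.14, VIII.6.7.
-/

set_option autoImplicit false

noncomputable section

open scoped Classical

open WeierstrassCurve Literature.NumberTheory.EllipticCurves
  Literature.NumberTheory.EllipticCurves.ModularForms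
  Literature.NumberTheory.EllipticCurves.Rank1Residual
  Literature.NumberTheory.EllipticCurves.Rank1Residual.Typed
  Literature.NumberTheory.GaloisRepresentations
  NumberField IsDedekindDomain
open Summit.BirchSwinnertonDyer.Rank1Residual.GaloisImage.DivisionDecider
  (threeNonDivCheckAt nine_le_index_range_zsmul_three_of_checks_inst)

namespace Summit.BirchSwinnertonDyer.Rank1Residual.Additive

/-- **X4 ∧ `r = 0`, potentially GOOD at `3`, `ord₃ #Ш_an ≤ 2`: `BSD(E,3)` from Kato's UPPER half and a
VISIBLE element of `Ш(E)[3]` by the COUNT road with the KERNEL index certificate** — n1011-p03's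
`X4RankZero.bsdp_of_congr_of_rank_two_of_kato` at `p = 3` with `hrank` REPLACED by: the partner's
integer model `W′ = ⟨a₁,…,a₆⟩`, points `P₁ = (x₁,y₁)`, `P₂ = (x₂,y₂)`, chord points `(x₃,y₃) = P₁ + P₂`,
`(x₄,y₄) = P₁ − P₂` (identities `hX₃ hY₃ hX₄ hY₄`), and four `threeNonDivCheckAt` certificates.
[cite: CremonaMazur2000, §3 and Table 1] [cite: AgasheStein2002, Thm. 3.1]
[cite: Kato2004Asterisque, Thm. 14.5 (3) (p. 236)] [cite: SilvermanAEC2009, Thm. X.4.14] -/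
theorem X4RankZero.bsdp_three_of_congr_of_indexChecks_of_kato
    (hKato : Kato2004.rankZero_padicValNat_sha_le_of_additive_potGood_of_imageContainsSL2)
    (hCT : exists_casselsTate_pairing (K := ℚ))
    (hGZK : rank_eq_analyticRank_of_analyticRank_le_one) (hmod : hasEntireLFunction_rat)
    (W : WeierstrassCurve ℚ) [W.IsElliptic] [W.IsGloballyMinimal]
    (hr : W.analyticRank = 0) (hX : haveI : Fact (Nat.Prime 3) := ⟨Nat.prime_three⟩; ClassX4 W 3)
    (hpot : 0 ≤ padicValRat 3 W.j)
    (hsurj : ∀ n : ℕ, W.HasSurjectiveModNGaloisRep (3 ^ n : ℕ)) (htam : ¬ 3 ∣ W.tamagawaProduct)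
    {N : ℕ} [NeZero N] (D : ModularParametrizationData W N) (hc : ¬ (3 : ℤ) ∣ D.maninConstant)
    {q : ℚ} (hq : shaAn W = (q : ℂ)) (hv : padicValRat 3 q ≤ 2)
    (W' : WeierstrassCurve ℚ) [W'.IsElliptic]
    (θ : geomTorsion W' ((3 : ℕ) : ℤ) ≃+ geomTorsion W ((3 : ℕ) : ℤ))
    (hθ : ∀ (σ : Field.absoluteGaloisGroup ℚ) (P : geomTorsion W' ((3 : ℕ) : ℤ)),
      θ (σ • P) = σ • θ P)
    (a₁ a₂ a₃ a₄ a₆ : ℤ) (hW' : W' = ⟨a₁, a₂, a₃, a₄, a₆⟩) {x₁ y₁ x₂ y₂ x₃ y₃ x₄ y₄ : ℚ}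
    (h₁ : W'.toAffine.Nonsingular x₁ y₁) (h₂ : W'.toAffine.Nonsingular x₂ y₂)
    (h₃ : W'.toAffine.Nonsingular x₃ y₃) (h₄ : W'.toAffine.Nonsingular x₄ y₄) (hx : x₁ ≠ x₂)
    (hX₃ : W'.toAffine.addX x₁ x₂ ((y₁ - y₂) / (x₁ - x₂)) = x₃)
    (hY₃ : W'.toAffine.addY x₁ x₂ y₁ ((y₁ - y₂) / (x₁ - x₂)) = y₃)
    (hX₄ : W'.toAffine.addX x₁ x₂ ((y₁ - W'.toAffine.negY x₂ y₂) / (x₁ - x₂)) = x₄)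
    (hY₄ : W'.toAffine.addY x₁ x₂ y₁ ((y₁ - W'.toAffine.negY x₂ y₂) / (x₁ - x₂)) = y₄)
    {ℓ₁ ℓ₂ ℓ₃ ℓ₄ : ℕ} [hℓ₁ : Fact ℓ₁.Prime] [hℓ₂ : Fact ℓ₂.Prime] [hℓ₃ : Fact ℓ₃.Prime]
    [hℓ₄ : Fact ℓ₄.Prime] {k₁ k₂ k₃ k₄ : ℕ}
    (hc₁ : threeNonDivCheckAt ℓ₁ a₁ a₂ a₃ a₄ a₆ x₁.num x₁.den k₁ = true)
    (hc₂ : threeNonDivCheckAt ℓ₂ a₁ a₂ a₃ a₄ a₆ x₂.num x₂.den k₂ = true)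
    (hc₃ : threeNonDivCheckAt ℓ₃ a₁ a₂ a₃ a₄ a₆ x₃.num x₃.den k₃ = true)
    (hc₄ : threeNonDivCheckAt ℓ₄ a₁ a₂ a₃ a₄ a₆ x₄.num x₄.den k₄ = true)
    (S : Finset (HeightOneSpectrum (𝓞 ℚ)))
    (hS : ∀ v : HeightOneSpectrum (𝓞 ℚ), v ∉ S →
      W.HasGoodReductionAt v ∧ W'.HasGoodReductionAt v ∧ ((3 : ℕ) : 𝓞 ℚ) ∉ v.asIdeal)
    (hloc : ∀ v ∈ S, Nat.card (nsmulAddMonoidHom 3 :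
      (W'.baseChange (v.adicCompletion ℚ)).toAffine.Point →+ _).ker = 1) :
    haveI : Fact (Nat.Prime 3) := ⟨Nat.prime_three⟩
    BSDp W 3 := by
  haveI : Fact (Nat.Prime 3) := ⟨Nat.prime_three⟩
  -- the tree's count theorem (`exists_sha_ne_zero_of_congr`, generic number field) carries the
  -- CLASSICAL `DecidableEq` on the point group `E(ℚ)`: make it the local instance so that every
  -- index term elaborated below is in the same currency (instance bookkeeping, no content)
  letI : DecidableEq ℚ := fun a b => Classical.propDecidable (a = b)
  haveI : Finite W.toAffine.Point := finite_point_of_analyticRank_eq_zero W hGZK hr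
  have hirr : Irr W 3 :=
    hasIrreducibleModPGaloisRep_of_hasSurjectiveModNGaloisRep W 3 (by simpa using hsurj 1)
  -- the count `[E(ℚ):3E(ℚ)] · ∏ #E′(ℚ_v)[3] · 3 < [E′(ℚ):3E′(ℚ)]` in the tree's (classical) currency:
  -- `1 · 1 · 3 < 9 ≤ index` by the kernel index certificate (FILE D7, instance-transported form)
  have hidx := nine_le_index_range_zsmul_three_of_checks_inst a₁ a₂ a₃ a₄ a₆ W' hW' h₁ h₂ h₃ h₄ hx
    hX₃ hY₃ hX₄ hY₄ hc₁ hc₂ hc₃ hc₄ (fun a b => Classical.propDecidable (a = b))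
  have hvis : ∃ c : W.sha, c ≠ 0 ∧ 3 • c = 0 := by
    refine W.exists_sha_ne_zero_of_congr W' (by norm_num) θ hθ S hS ?_
    rw [index_range_zsmul_eq_one_of_coprime (coprime_natCard_point_of_irr W 3 hirr), one_mul,
      Finset.prod_eq_one hloc, one_mul, Module.finrank_self, pow_one]
    exact lt_of_lt_of_le (by norm_num) hidx
  have hlow : MissingLowerBoundAt W 3 :=
    missingLowerBoundAt_of_casselsTate_of_pow_dvd W 3 hCT (hGZK W (by rw [hr]; exact Nat.zero_le 1)).2 hq (k := 1)
      (by simpa using hv) (by simpa using dvd_shaOrder_of_exists_torsion W 3 hvis)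
  exact X4RankZero.bsdp_of_missingLowerBoundAt_of_kato W 3 hKato hGZK hmod hr hX hpot hsurj htam D hc
    hlow

/-- **X4 ∧ `r = 0`, potentially MULTIPLICATIVE at `3`, `ρ̄_{E,3}` onto, `ord₃ #Ш_an ≤ 2`: `BSD(E,3)`
from the (M)-chain UPPER half and a VISIBLE element of `Ш(E)[3]` by the COUNT road with the KERNEL
index certificate** — n1011-p03's `X4RankZero.bsdp_three_potMult_of_congr_of_rank_two` with `hrank`
REPLACED by the FILE D7 certificate binders; every other binder and the proof tail verbatim.
[cite: CremonaMazur2000, §3 and Table 1] [cite: AgasheStein2002, Thm. 3.1]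
[cite: Delbourgo1998, Prop. 4 (p. 144)] [cite: SilvermanAEC2009, Thm. X.4.2 (a) and X.4.14] -/
theorem X4RankZero.bsdp_three_potMult_of_congr_of_indexChecks
    (hKatoS : Kato2004.rankZero_padicValNat_sha_le_sub_localTamagawa_of_additive_potGood_of_imageContainsSL2)
    (hDel : Delbourgo1998.prop4_rankZero_pow_dvd_constantCoeff)
    (hGZK : rank_eq_analyticRank_of_analyticRank_le_one) (hmod : hasEntireLFunction_rat)
    (hmodD : nonempty_modularParametrizationData)
    (hKatoχ : Wuthrich2014.kato_halfEigenCharIdeal_dvd_cyclotomicPrime_of_surjective)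
    (hCT : exists_casselsTate_pairing (K := ℚ))
    (W : WeierstrassCurve ℚ) [W.IsElliptic] [W.IsGloballyMinimal] (hr : W.analyticRank = 0)
    (hX : haveI : Fact (Nat.Prime 3) := ⟨Nat.prime_three⟩; ClassX4 W 3)
    (hsurj : W.HasSurjectiveModNGaloisRep 3) (hj : padicValRat 3 W.j < 0)
    {q : ℚ} (hq : shaAn W = (q : ℂ)) (hv : padicValRat 3 q ≤ 2)
    (W' : WeierstrassCurve ℚ) [W'.IsElliptic]
    (θ : geomTorsion W' ((3 : ℕ) : ℤ) ≃+ geomTorsion W ((3 : ℕ) : ℤ))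
    (hθ : ∀ (σ : Field.absoluteGaloisGroup ℚ) (P : geomTorsion W' ((3 : ℕ) : ℤ)),
      θ (σ • P) = σ • θ P)
    (a₁ a₂ a₃ a₄ a₆ : ℤ) (hW' : W' = ⟨a₁, a₂, a₃, a₄, a₆⟩) {x₁ y₁ x₂ y₂ x₃ y₃ x₄ y₄ : ℚ}
    (h₁ : W'.toAffine.Nonsingular x₁ y₁) (h₂ : W'.toAffine.Nonsingular x₂ y₂)
    (h₃ : W'.toAffine.Nonsingular x₃ y₃) (h₄ : W'.toAffine.Nonsingular x₄ y₄) (hx : x₁ ≠ x₂)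
    (hX₃ : W'.toAffine.addX x₁ x₂ ((y₁ - y₂) / (x₁ - x₂)) = x₃)
    (hY₃ : W'.toAffine.addY x₁ x₂ y₁ ((y₁ - y₂) / (x₁ - x₂)) = y₃)
    (hX₄ : W'.toAffine.addX x₁ x₂ ((y₁ - W'.toAffine.negY x₂ y₂) / (x₁ - x₂)) = x₄)
    (hY₄ : W'.toAffine.addY x₁ x₂ y₁ ((y₁ - W'.toAffine.negY x₂ y₂) / (x₁ - x₂)) = y₄)
    {ℓ₁ ℓ₂ ℓ₃ ℓ₄ : ℕ} [hℓ₁ : Fact ℓ₁.Prime] [hℓ₂ : Fact ℓ₂.Prime] [hℓ₃ : Fact ℓ₃.Prime]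
    [hℓ₄ : Fact ℓ₄.Prime] {k₁ k₂ k₃ k₄ : ℕ}
    (hc₁ : threeNonDivCheckAt ℓ₁ a₁ a₂ a₃ a₄ a₆ x₁.num x₁.den k₁ = true)
    (hc₂ : threeNonDivCheckAt ℓ₂ a₁ a₂ a₃ a₄ a₆ x₂.num x₂.den k₂ = true)
    (hc₃ : threeNonDivCheckAt ℓ₃ a₁ a₂ a₃ a₄ a₆ x₃.num x₃.den k₃ = true)
    (hc₄ : threeNonDivCheckAt ℓ₄ a₁ a₂ a₃ a₄ a₆ x₄.num x₄.den k₄ = true)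
    (S : Finset (HeightOneSpectrum (𝓞 ℚ)))
    (hS : ∀ v : HeightOneSpectrum (𝓞 ℚ), v ∉ S →
      W.HasGoodReductionAt v ∧ W'.HasGoodReductionAt v ∧ ((3 : ℕ) : 𝓞 ℚ) ∉ v.asIdeal)
    (hloc : ∀ v ∈ S, Nat.card (nsmulAddMonoidHom 3 :
      (W'.baseChange (v.adicCompletion ℚ)).toAffine.Point →+ _).ker = 1) :
    haveI : Fact (Nat.Prime 3) := ⟨Nat.prime_three⟩
    BSDp W 3 := by
  haveI : Fact (Nat.Prime 3) := ⟨Nat.prime_three⟩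
  -- the tree's count theorem (`exists_sha_ne_zero_of_congr`, generic number field) carries the
  -- CLASSICAL `DecidableEq` on the point group `E(ℚ)`: make it the local instance so that every
  -- index term elaborated below is in the same currency (instance bookkeeping, no content)
  letI : DecidableEq ℚ := fun a b => Classical.propDecidable (a = b)
  haveI : Finite W.toAffine.Point := finite_point_of_analyticRank_eq_zero W hGZK hr
  have hirr : Irr W 3 := hasIrreducibleModPGaloisRep_of_hasSurjectiveModNGaloisRep W 3 hsurj
  have hidx := nine_le_index_range_zsmul_three_of_checks_inst a₁ a₂ a₃ a₄ a₆ W' hW' h₁ h₂ h₃ h₄ hx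
    hX₃ hY₃ hX₄ hY₄ hc₁ hc₂ hc₃ hc₄ (fun a b => Classical.propDecidable (a = b))
  have hvis : ∃ c : W.sha, c ≠ 0 ∧ 3 • c = 0 := by
    refine W.exists_sha_ne_zero_of_congr W' (by norm_num) θ hθ S hS ?_
    rw [index_range_zsmul_eq_one_of_coprime (coprime_natCard_point_of_irr W 3 hirr), one_mul,
      Finset.prod_eq_one hloc, one_mul, Module.finrank_self, pow_one]
    exact lt_of_lt_of_le (by norm_num) hidx
  obtain ⟨c, hc0, hc3⟩ := hvis
  -- `Sel^(3)(E/ℚ) ↠ Ш(E/ℚ)[3]`: a preimage of the visible class is a non-zero Selmer element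
  obtain ⟨z, hz⟩ := exists_selmerToSha_eq W (n := ((3 : ℕ) : ℤ)) (by norm_num) c (by exact_mod_cast hc3)
  have hSel : W.selmerGroup ((3 : ℕ) : ℤ) ≠ ⊥ := by
    intro hbot
    have hmem : (z : W.galH1Torsion ((3 : ℕ) : ℤ)) ∈ (⊥ : AddSubgroup _) := hbot ▸ z.2
    have hz0 : z = 0 := Subtype.ext ((AddSubgroup.mem_bot).mp hmem)
    exact hc0 (by rw [← hz, hz0, map_zero])
  exact X4RankZero.bsdp_three_potMult_of_selmerGroup_ne_bot_noL20 W hKatoS hDel hGZK hmod hmodD hKatoχ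
    hCT hr hX hsurj hj hq hv hSel

end Summit.BirchSwinnertonDyer.Rank1Residual.Additive

end
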